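import Mathlib
import Literature.Analysis.FunctionSpaces.FlatTorusProofs
import Summits.NavierStokesRegularity.NavierStokesRegularity.Theorems.TypeILiouvilleGlobalFadingAnchor

/-!
# TypeILiouvilleLatticeMomentum — crux (L) stmt-NavierStokesRegularity-10661 `TypeIliouvilleL`:
# the SPATIALLY LATTICE-PERIODIC stratum of print's class P — conservation of the cell momentum

Helper for stmt-NavierStokesRegularity-10661 (`--supports`); theorems only, no definitions, no named-fact
hypotheses; closes no item; Navier–Stokes regularity is NOT proved here (leafhand seat of the
EulerZoomLiouville route, LAND-ONLY).

Class P = print's class of bounded ancient mild solutions (KNSS 2009 §4 (i); the binders of the registered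
stubs `stub_quiescentLiouville` / `stub_persistent_mild_backward_L3_recurrence` verbatim): `v : ℝ → ℝ³ → ℝ³`
continuous and bounded on `(−∞,0) × ℝ³`, solving the Oseen integral equation
`v(t) = e^{(t−s)Δ}v(s) − B¹_s(v,v)(t)` for all `s < t < 0`.

* `setIntegral_unitCube_comp_add_right` — the cell integral `∫_{[0,1)³} g(· + x)` of a `ℤ³`-periodic `g`
  does not depend on the shift `x` (descent to the flat torus `ℝ³/ℤ³`, invariance of its Haar measure).
* `norm_setIntegral_ball_sub_setIntegral_ball_le` — for `‖z‖ ≤ 2 ≤ R` and `‖g‖ ≤ K`,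
  `‖∫_{B(z,R)} g − ∫_{B(0,R)} g‖ ≤ 2K (|B_R| − |B_{R−2}|)` (both balls squeeze `B(0,R−2)`).
* `tendsto_ballAverage_of_isLatticePeriodic` — **ball averages of a bounded continuous `ℤ³`-periodic
  function tend to its cell mean**: `⨍_{B(0,R)} g → ∫_{[0,1)³} g` as `R → ∞` (average the shifted ball
  integrals over one cell and use Fubini: `∫_{z∈[0,1)³} ∫_{B(0,R)} g(x+z) = |B_R| · ∫_{[0,1)³} g`, while each
  shifted integral differs from the unshifted one by `≤ 2K(|B_R| − |B_{R−2}|) = o(|B_R|)`).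
* `classP_cellMean_eq_of_isLatticePeriodic` — **in class P, a member whose slices are `ℤ³`-periodic has a
  time-independent cell mean `∫_{[0,1)³} v(t,x) dx`** (conservation of momentum): the landed KNSS momentum
  anchor `TypeILiouvilleGlobalFadingAnchor.tendsto_ballAverage_sub` («the mean at infinity does not move»,
  `⨍_{B_R}(v(t) − v(s)) → 0`) against the cell-mean limit of the periodic slice difference.

READING for (L): this is the class-P input of the spatially periodic stratum — it pins the Galilean drift
`b(t)` of the parasitic solutions `V(t, x − ξ(t)) + ξ'(t)` (KNSS 2009 Remark 6.1), i.e. the linear part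
`−m'(t)·x` of any classical pressure of a periodic member vanishes.  What remains for the full sieve
«every `ℤ³`-periodic class-P member is one constant vector» is print-routine on the flat torus: descend to
`ℝ³/ℤ³` (`Literature.Analysis.FluidPDE.IsClassicalNSSolutionOn.to_torus_holds`), subtract the conserved mean by
the class-P Galilean boost, and run the Poincaré/energy decay
`Literature.Analysis.FluidPDE.torus_kineticEnergy_le_mul_exp` backwards from `t → −∞` against the bound `K`.
[cite: KochNadirashviliSereginSverak2009, §4 p. 8 and Remark 6.1 (arXiv:0709.3599)]; [cite: Grafakos2014, §3.1.1]
-/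

noncomputable section
open MeasureTheory Filter Set Function Metric
open scoped Topology
open Literature.Analysis Literature.Analysis.FunctionSpaces
set_option linter.dupNamespace false
namespace Summit.NavierStokesRegularity.NavierStokesRegularity.Theorems.TypeILiouvilleLatticeMomentum

variable {F : Type*} [NormedAddCommGroup F] [NormedSpace ℝ F] [CompleteSpace F]

/-! ## §1 The cell integral of a periodic function is shift invariant -/

/-- The unit cell `[0,1)³` has Lebesgue measure `1` (the projection to `ℝ³/ℤ³` is measure preserving onto a
probability space). [cite: Grafakos2014, §3.1.1] -/
theorem volume_unitCube : volume (Torus.unitCube (Fin 3)) = 1 := by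
  have hmp := Torus.measurePreserving_proj_unitCube_holds (d := Fin 3)
  have h := hmp.measure_preimage (MeasurableSet.univ : MeasurableSet
    (univ : Set (UnitAddTorus (Fin 3)))).nullMeasurableSet
  rw [preimage_univ, Measure.restrict_apply_univ, measure_univ] at h
  exact h

/-- Real form: `volume.real [0,1)³ = 1`. [cite: Grafakos2014, §3.1.1] -/
theorem volume_real_unitCube : volume.real (Torus.unitCube (Fin 3)) = 1 := by
  simp [measureReal_def, volume_unitCube]

omit [CompleteSpace F] in
/-- **Shift invariance of the cell integral of a `ℤ³`-periodic function**:
`∫_{[0,1)³} g(z + x) dz = ∫_{[0,1)³} g(z) dz` for every `x` (descend `g` to the flat torus, where the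
Haar measure is translation invariant, and come back by `∫_{T³} f = ∫_{[0,1)³} f ∘ proj`). [cite: Grafakos2014, §3.1.1] -/
theorem setIntegral_unitCube_comp_add_right {g : EuclideanSpace ℝ (Fin 3) → F}
    (hg : Torus.IsLatticePeriodic g) (x : EuclideanSpace ℝ (Fin 3)) :
    ∫ z in Torus.unitCube (Fin 3), g (z + x) = ∫ z in Torus.unitCube (Fin 3), g z := by
  have hlift : Torus.lift (Torus.descend g hg) = g := Torus.lift_descend_holds g hg
  set G : UnitAddTorus (Fin 3) → F := Torus.descend g hg with hG
  have h1 : (fun z => g (z + x)) = Torus.lift (fun w => G (w + Torus.proj x)) := by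
    funext z
    rw [Torus.lift_apply, ← Torus.proj_add, ← Torus.lift_apply G, hlift]
  rw [h1, ← Torus.integral_eq_integral_lift_holds, integral_add_right_eq_self G (Torus.proj x),
    Torus.integral_eq_integral_lift_holds G, hlift]

/-! ## §2 Geometry of large balls -/

/-- Points of the unit cell have norm at most `2` (`‖z‖² = Σ zᵢ² < 3`). [folklore] -/
theorem norm_le_two_of_mem_unitCube {z : EuclideanSpace ℝ (Fin 3)} (hz : z ∈ Torus.unitCube (Fin 3)) :
    ‖z‖ ≤ 2 := by
  rw [Torus.mem_unitCube] at hz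
  have hcoord : ∀ i, ‖z i‖ ^ 2 ≤ 1 := by
    intro i
    have h0 := (hz i).1
    have h1 := (hz i).2
    rw [Real.norm_eq_abs, abs_of_nonneg h0]
    nlinarith
  have hsum : ∑ i, ‖z i‖ ^ 2 ≤ 4 := by
    rw [Fin.sum_univ_three]
    linarith [hcoord 0, hcoord 1, hcoord 2]
  rw [EuclideanSpace.norm_eq]
  calc Real.sqrt (∑ i, ‖z i‖ ^ 2) ≤ Real.sqrt 4 := Real.sqrt_le_sqrt hsum
    _ = 2 := by
      rw [show (4 : ℝ) = 2 ^ 2 by norm_num, Real.sqrt_sq (by norm_num : (0 : ℝ) ≤ 2)]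

/-- Volume scaling of balls in `ℝ³`: `|B(0,r)| = r³ |B(0,1)|` (real form). [folklore] -/
theorem volume_real_ball_eq (r : ℝ) (hr : 0 < r) :
    volume.real (ball (0 : EuclideanSpace ℝ (Fin 3)) r) =
      r ^ 3 * volume.real (ball (0 : EuclideanSpace ℝ (Fin 3)) 1) := by
  rw [measureReal_def, Measure.addHaar_ball_of_pos volume (0 : EuclideanSpace ℝ (Fin 3)) hr,
    finrank_euclideanSpace_fin, ENNReal.toReal_mul, ENNReal.toReal_ofReal (by positivity),
    measureReal_def]

omit [CompleteSpace F] in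
/-- **Shifted large balls carry almost the same integral**: for `‖g‖ ≤ K`, `‖z‖ ≤ 2`,
`‖∫_{B(z,R)} g − ∫_{B(0,R)} g‖ ≤ 2K(|B(0,R)| − |B(0,R−2)|)`, both balls containing `B(0,R−2)` and having the
volume of `B(0,R)`. [folklore] -/
theorem norm_setIntegral_ball_sub_setIntegral_ball_le {g : EuclideanSpace ℝ (Fin 3) → F} {K : ℝ}
    (hgm : AEStronglyMeasurable g volume) (hK : ∀ x, ‖g x‖ ≤ K) {z : EuclideanSpace ℝ (Fin 3)}
    (hz : ‖z‖ ≤ 2) (R : ℝ) :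
    ‖(∫ y in ball z R, g y) - ∫ y in ball (0 : EuclideanSpace ℝ (Fin 3)) R, g y‖ ≤
      2 * K * (volume.real (ball (0 : EuclideanSpace ℝ (Fin 3)) R) -
        volume.real (ball (0 : EuclideanSpace ℝ (Fin 3)) (R - 2))) := by
  have hK0 : 0 ≤ K := (norm_nonneg _).trans (hK 0)
  -- the small ball sits in both large balls
  have hsub0 : ball (0 : EuclideanSpace ℝ (Fin 3)) (R - 2) ⊆ ball (0 : EuclideanSpace ℝ (Fin 3)) R :=
    ball_subset_ball (by linarith)
  have hsubz : ball (0 : EuclideanSpace ℝ (Fin 3)) (R - 2) ⊆ ball z R := by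
    intro y hy
    rw [mem_ball, dist_eq_norm] at hy ⊢
    rw [sub_zero] at hy
    calc ‖y - z‖ ≤ ‖y‖ + ‖z‖ := norm_sub_le y z
      _ < R := by linarith
  have hint : ∀ (c : EuclideanSpace ℝ (Fin 3)) (r : ℝ), IntegrableOn g (ball c r) volume := fun c r =>
    Measure.integrableOn_of_bounded (M := K) measure_ball_lt_top.ne hgm (ae_of_all _ fun x => hK x)
  -- each large ball minus the small ball
  have hdiff : ∀ (c : EuclideanSpace ℝ (Fin 3)), ball (0 : EuclideanSpace ℝ (Fin 3)) (R - 2) ⊆ ball c R →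
      ‖(∫ y in ball c R, g y) - ∫ y in ball (0 : EuclideanSpace ℝ (Fin 3)) (R - 2), g y‖ ≤
        K * (volume.real (ball (0 : EuclideanSpace ℝ (Fin 3)) R) -
          volume.real (ball (0 : EuclideanSpace ℝ (Fin 3)) (R - 2))) := by
    intro c hsub
    rw [← setIntegral_sdiff measurableSet_ball (hint c R) hsub]
    calc ‖∫ y in ball c R \ ball 0 (R - 2), g y‖
        ≤ K * volume.real (ball c R \ ball 0 (R - 2)) :=
          norm_setIntegral_le_of_norm_le_const
            (lt_of_le_of_lt (measure_mono sdiff_subset) measure_ball_lt_top) fun x _ => hK x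
      _ = K * (volume.real (ball (0 : EuclideanSpace ℝ (Fin 3)) R) -
            volume.real (ball (0 : EuclideanSpace ℝ (Fin 3)) (R - 2))) := by
          rw [measureReal_sdiff hsub measurableSet_ball measure_ball_lt_top.ne,
            Measure.addHaar_real_ball_center volume c R]
  have h1 := hdiff z hsubz
  have h2 := hdiff 0 hsub0
  calc ‖(∫ y in ball z R, g y) - ∫ y in ball (0 : EuclideanSpace ℝ (Fin 3)) R, g y‖
      = ‖((∫ y in ball z R, g y) - ∫ y in ball (0 : EuclideanSpace ℝ (Fin 3)) (R - 2), g y) -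
          ((∫ y in ball (0 : EuclideanSpace ℝ (Fin 3)) R, g y) -
            ∫ y in ball (0 : EuclideanSpace ℝ (Fin 3)) (R - 2), g y)‖ := by
        congr 1; abel
    _ ≤ ‖(∫ y in ball z R, g y) - ∫ y in ball (0 : EuclideanSpace ℝ (Fin 3)) (R - 2), g y‖ +
          ‖(∫ y in ball (0 : EuclideanSpace ℝ (Fin 3)) R, g y) -
            ∫ y in ball (0 : EuclideanSpace ℝ (Fin 3)) (R - 2), g y‖ := norm_sub_le _ _
    _ ≤ _ := by linarith

/-! ## §3 Ball averages of periodic functions converge to the cell mean -/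

omit [CompleteSpace F] in
/-- The shifted ball integral is the integral over the shifted ball:
`∫_{B(0,R)} g(x + z) dx = ∫_{B(z,R)} g`. [folklore] -/
theorem setIntegral_ball_comp_add_right (g : EuclideanSpace ℝ (Fin 3) → F)
    (z : EuclideanSpace ℝ (Fin 3)) (R : ℝ) :
    ∫ x in ball (0 : EuclideanSpace ℝ (Fin 3)) R, g (x + z) = ∫ y in ball z R, g y := by
  have hpre : (fun x : EuclideanSpace ℝ (Fin 3) => x + z) ⁻¹' ball z R =
      ball (0 : EuclideanSpace ℝ (Fin 3)) R := by
    ext x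
    simp [mem_ball, dist_eq_norm]
  rw [← hpre]
  exact (measurePreserving_add_right volume z).setIntegral_preimage_emb
    (measurableEmbedding_addRight z) g (ball z R)

/-- **Ball averages of a bounded continuous `ℤ³`-periodic function tend to its cell mean**:
`⨍_{B(0,R)} g → ∫_{[0,1)³} g` as `R → ∞`.  Quantitatively, for `R ≥ 2`,
`‖⨍_{B(0,R)} g − ∫_{[0,1)³} g‖ ≤ 2K(1 − ((R−2)/R)³)`. [cite: Grafakos2014, §3.1.1] -/
theorem tendsto_ballAverage_of_isLatticePeriodic {g : EuclideanSpace ℝ (Fin 3) → F} {K : ℝ}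
    (hg : Torus.IsLatticePeriodic g) (hgc : Continuous g) (hK : ∀ x, ‖g x‖ ≤ K) :
    Tendsto (fun R : ℝ => ⨍ x in ball (0 : EuclideanSpace ℝ (Fin 3)) R, g x) atTop
      (𝓝 (∫ z in Torus.unitCube (Fin 3), g z)) := by
  set M : F := ∫ z in Torus.unitCube (Fin 3), g z with hM
  set ω : ℝ := volume.real (ball (0 : EuclideanSpace ℝ (Fin 3)) 1) with hω
  have hω0 : 0 < ω := by
    rw [hω, measureReal_def]
    exact ENNReal.toReal_pos (measure_ball_pos volume _ one_pos).ne' measure_ball_lt_top.ne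
  have hK0 : 0 ≤ K := (norm_nonneg _).trans (hK 0)
  have hgm : AEStronglyMeasurable g volume := hgc.aestronglyMeasurable
  -- the quantitative bound for `R ≥ 2`
  have hbound : ∀ R : ℝ, 2 < R →
      ‖(⨍ x in ball (0 : EuclideanSpace ℝ (Fin 3)) R, g x) - M‖ ≤ 2 * K * (1 - ((R - 2) / R) ^ 3) := by
    intro R hR
    have hR0 : 0 < R := by linarith
    set B := ball (0 : EuclideanSpace ℝ (Fin 3)) R with hB
    set Q := Torus.unitCube (Fin 3) with hQ
    have hBvol : volume.real B = R ^ 3 * ω := volume_real_ball_eq R hR0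
    have hBpos : 0 < volume.real B := by rw [hBvol]; positivity
    haveI : IsFiniteMeasure (volume.restrict B) := isFiniteMeasure_restrict.2 measure_ball_lt_top.ne
    haveI : IsFiniteMeasure (volume.restrict Q) :=
      isFiniteMeasure_restrict.2 (by rw [volume_unitCube]; exact ENNReal.one_ne_top)
    -- Fubini for the bounded continuous integrand `(z, x) ↦ g (x + z)` on `Q × B`
    have hFi : Integrable (uncurry fun (z x : EuclideanSpace ℝ (Fin 3)) => g (x + z))
        ((volume.restrict Q).prod (volume.restrict B)) := by
      refine Integrable.of_bound ?_ K (ae_of_all _ fun q => hK _)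
      have hc : Continuous (uncurry fun (z x : EuclideanSpace ℝ (Fin 3)) => g (x + z)) :=
        hgc.comp (continuous_snd.add continuous_fst)
      exact hc.aestronglyMeasurable
    have hswap : ∫ z in Q, ∫ x in B, g (x + z) = ∫ x in B, ∫ z in Q, g (x + z) :=
      integral_integral_swap hFi
    -- the inner cell integrals are all `M`
    have hinner : ∀ x : EuclideanSpace ℝ (Fin 3), ∫ z in Q, g (x + z) = M := by
      intro x
      have : (fun z => g (x + z)) = fun z => g (z + x) := by funext z; rw [add_comm]
      rw [this]
      exact setIntegral_unitCube_comp_add_right hg x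
    have hav : ∫ z in Q, ∫ x in B, g (x + z) = (volume.real B) • M := by
      rw [hswap]
      simp_rw [hinner]
      rw [setIntegral_const]
    -- compare with the unshifted ball integral, cell-averaged
    set I : F := ∫ x in B, g x with hI
    have hIint : ∫ _z in Q, I = I := by
      rw [setIntegral_const, volume_real_unitCube, one_smul]
    have hshift_int : Integrable (fun z => ∫ x in B, g (x + z)) (volume.restrict Q) :=
      hFi.integral_prod_left
    have hkey : I - (volume.real B) • M = ∫ z in Q, (I - ∫ x in B, g (x + z)) := by
      rw [integral_sub (integrable_const I) hshift_int, hIint, hav]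
    have hest : ‖I - (volume.real B) • M‖ ≤
        2 * K * (volume.real B - volume.real (ball (0 : EuclideanSpace ℝ (Fin 3)) (R - 2))) := by
      rw [hkey]
      calc ‖∫ z in Q, (I - ∫ x in B, g (x + z))‖
          ≤ 2 * K * (volume.real B - volume.real (ball (0 : EuclideanSpace ℝ (Fin 3)) (R - 2))) *
              volume.real Q := by
            refine norm_setIntegral_le_of_norm_le_const
              (by rw [volume_unitCube]; exact ENNReal.one_lt_top) fun z hz => ?_
            rw [setIntegral_ball_comp_add_right g z R, ← norm_neg, neg_sub]
            exact norm_setIntegral_ball_sub_setIntegral_ball_le hgm hK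
              (norm_le_two_of_mem_unitCube hz) R
        _ = 2 * K * (volume.real B - volume.real (ball (0 : EuclideanSpace ℝ (Fin 3)) (R - 2))) := by
            rw [hQ, volume_real_unitCube, mul_one]
    -- divide by `|B|`
    have havg : (⨍ x in B, g x) - M = (volume.real B)⁻¹ • (I - (volume.real B) • M) := by
      rw [setAverage_eq, smul_sub, ← hI, smul_smul, inv_mul_cancel₀ hBpos.ne', one_smul]
    rw [havg, norm_smul, norm_inv, Real.norm_of_nonneg hBpos.le]
    have hsmall : volume.real (ball (0 : EuclideanSpace ℝ (Fin 3)) (R - 2)) = (R - 2) ^ 3 * ω :=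
      volume_real_ball_eq (R - 2) (by linarith)
    calc (volume.real B)⁻¹ * ‖I - (volume.real B) • M‖
        ≤ (volume.real B)⁻¹ *
            (2 * K * (volume.real B - volume.real (ball (0 : EuclideanSpace ℝ (Fin 3)) (R - 2)))) :=
          mul_le_mul_of_nonneg_left hest (inv_nonneg.2 hBpos.le)
      _ = 2 * K * (1 - ((R - 2) / R) ^ 3) := by
          rw [hBvol, hsmall]
          field_simp
  -- the right-hand side tends to `0`
  have hlim : Tendsto (fun R : ℝ => 2 * K * (1 - ((R - 2) / R) ^ 3)) atTop (𝓝 0) := by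
    have h1 : Tendsto (fun R : ℝ => (R - 2) / R) atTop (𝓝 1) := by
      have h2 : Tendsto (fun R : ℝ => 1 - 2 * R⁻¹) atTop (𝓝 (1 - 2 * 0)) :=
        tendsto_const_nhds.sub (tendsto_inv_atTop_zero.const_mul 2)
      rw [mul_zero, sub_zero] at h2
      refine h2.congr' ?_
      filter_upwards [eventually_gt_atTop (0 : ℝ)] with R hR
      field_simp
    have h3 : Tendsto (fun R : ℝ => 2 * K * (1 - ((R - 2) / R) ^ 3)) atTop
        (𝓝 (2 * K * (1 - 1 ^ 3))) :=
      (tendsto_const_nhds.sub (h1.pow 3)).const_mul (2 * K)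
    simpa using h3
  rw [tendsto_iff_norm_sub_tendsto_zero]
  refine squeeze_zero_norm' ?_ hlim
  filter_upwards [eventually_gt_atTop (2 : ℝ)] with R hR
  rw [Real.norm_of_nonneg (norm_nonneg _)]
  exact hbound R hR

/-! ## §4 Class P: spatially periodic members have conserved cell momentum -/

/-- **Conservation of the cell momentum for spatially periodic members of print's class** (KNSS 2009 §4:
«the mean at infinity does not move»; its periodic reading).  If `v` is continuous and bounded on
`(−∞,0) × ℝ³`, satisfies the Oseen integral equation for all `s < t < 0`, and every slice `v(t,·)` is
`ℤ³`-periodic, then `∫_{[0,1)³} v(t,x) dx = ∫_{[0,1)³} v(s,x) dx` for all `s, t < 0`.  Proof: the landed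
momentum anchor `TypeILiouvilleGlobalFadingAnchor.tendsto_ballAverage_sub` gives
`⨍_{B_R}(v(t) − v(s)) → 0`, while `tendsto_ballAverage_of_isLatticePeriodic` identifies the same limit as the
cell mean of the periodic slice difference. [cite: KochNadirashviliSereginSverak2009, §4 p. 8 and Remark 6.1 (arXiv:0709.3599)] -/
theorem classP_cellMean_eq_of_isLatticePeriodic
    {v : ℝ → EuclideanSpace ℝ (Fin 3) → EuclideanSpace ℝ (Fin 3)}
    (hc : ContinuousOn (uncurry v) (Iio 0 ×ˢ univ))
    (hK : ∃ K : ℝ, ∀ t < 0, ∀ x, ‖v t x‖ ≤ K)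
    (hm : ∀ s t : ℝ, s < t → t < 0 → ∀ x,
      v t x = Literature.Analysis.UnboundedOperators.heatExtension (v s) (t - s) x -
        Literature.Analysis.FluidPDE.oseenDuhamel 1 s v v t x)
    (hper : ∀ t < 0, Torus.IsLatticePeriodic (v t)) {s t : ℝ} (hs : s < 0) (ht : t < 0) :
    ∫ x in Torus.unitCube (Fin 3), v t x = ∫ x in Torus.unitCube (Fin 3), v s x := by
  -- symmetric in `s, t`: reduce to `s < t`
  wlog hst : s < t generalizing s t
  · rcases eq_or_lt_of_le (not_lt.1 hst) with h | h
    · rw [h]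
    · exact (this ht hs h).symm
  obtain ⟨K, hKb⟩ := hK
  have hslice : ∀ τ < 0, Continuous (v τ) := fun τ hτ =>
    hc.comp_continuous (f := fun x : EuclideanSpace ℝ (Fin 3) => (τ, x)) (by fun_prop)
      fun x => ⟨hτ, mem_univ _⟩
  set g : EuclideanSpace ℝ (Fin 3) → EuclideanSpace ℝ (Fin 3) := fun x => v t x - v s x with hg_def
  have hgp : Torus.IsLatticePeriodic g := by
    intro j x
    simp only [hg_def]
    rw [hper t ht j x, hper s hs j x]
  have hgc : Continuous g := (hslice t ht).sub (hslice s hs)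
  have hgK : ∀ x, ‖g x‖ ≤ K + K := fun x =>
    (norm_sub_le _ _).trans (add_le_add (hKb t ht x) (hKb s hs x))
  have h1 : Tendsto (fun R : ℝ => ⨍ x in ball (0 : EuclideanSpace ℝ (Fin 3)) R, g x) atTop
      (𝓝 (∫ z in Torus.unitCube (Fin 3), g z)) :=
    tendsto_ballAverage_of_isLatticePeriodic hgp hgc hgK
  have h2 : Tendsto (fun R : ℝ => ⨍ x in ball (0 : EuclideanSpace ℝ (Fin 3)) R, g x) atTop (𝓝 0) :=
    TypeILiouvilleGlobalFading.tendsto_ballAverage_sub hc ⟨K, hKb⟩ hm hst ht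
  have h0 : ∫ z in Torus.unitCube (Fin 3), g z = 0 := tendsto_nhds_unique h1 h2
  have hQfin : volume (Torus.unitCube (Fin 3)) ≠ ⊤ := by
    rw [volume_unitCube]; exact ENNReal.one_ne_top
  have hit : IntegrableOn (v t) (Torus.unitCube (Fin 3)) volume :=
    Measure.integrableOn_of_bounded (M := K) hQfin (hslice t ht).aestronglyMeasurable
      (ae_of_all _ fun x => hKb t ht x)
  have his : IntegrableOn (v s) (Torus.unitCube (Fin 3)) volume :=
    Measure.integrableOn_of_bounded (M := K) hQfin (hslice s hs).aestronglyMeasurable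
      (ae_of_all _ fun x => hKb s hs x)
  have hsub : ∫ z in Torus.unitCube (Fin 3), g z =
      (∫ x in Torus.unitCube (Fin 3), v t x) - ∫ x in Torus.unitCube (Fin 3), v s x :=
    integral_sub hit his
  rw [hsub] at h0
  exact sub_eq_zero.1 h0

end Summit.NavierStokesRegularity.NavierStokesRegularity.Theorems.TypeILiouvilleLatticeMomentum

end
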